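import Mathlib.Algebra.BigOperators.Group.Finset.Basic
import HarnessLib

/-!
# Venture HSemireg — THE FIBRE PARTITION (combinatorial core of THEOREM F, door (I), every level)

Kernel form of the fifteen-line partition argument of `p2/wlaws/FIBRE-PARTITION-p2g12.md` §2
(cell pub-hsemireg, seat p2 gen 12).  The GEOMETRY is NOT formalised here: the hypotheses below are
the named lemmas of that note, each a necessary condition on a reduced flat-LEGO configuration
`Z ⊂ S₁ × S₂ × S₃` at the cell's «named-lemma tier» — the corrected (R1) A-row and A′-row of every
Weil triple (`rowA`, `rowA'`), the W-law (W3) for the A-systems (`balA`; NOT needed for the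
A′-systems), the A-fan and A′-fan in their catalogue form, i.e. for NON-PARALLEL members only (`fanA`,
`fanA'`; the «upgrade» to parallel members is DERIVED here from `balA`, see `fan_all`), the pad-pair
product pattern (A·A′) (`pairAA'`: through the curve
`p × q × m` pass two CROSSED triples) and its companion pattern fact (X·A) ∕ (X·A′) (`crossA`,
`crossA'`: a crossed pair of triples over `m` through `(p,q)` together with one of the two pads forces
the other) — all catalogue-checked ∕ hand-derived THERE, and simply ASSUMED here as abstract
incidence axioms.  What the kernel checks is the deduction «these axioms ⇒ every slot-3 fibre is
balanced», i.e. the partition argument itself.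

ABSTRACT SETTING.  `M` = the sloped slot-3 lines, `slope : M → Fin 3`; `P₁`, `P₂` = grid points of
slots 1, 2; `L₁`, `L₂` = lines of slots 1, 2 (any direction) with incidence `on₁`, `on₂`;
`F ℓ L : Finset M` = the slot-3 FIBRE over `(ℓ, L)` (the sloped `m` with `ℓ × L × m ⊂ Z`),
`SA p` = the sloped part of the A-system at `p` (the `m` with `p × S₂ × m ⊂ Z`), `SA' q` = the A′-system
at `q`.  «Balanced» = every slope occurs equally often: `#{m ∈ S | slope m = c}` independent of `c`.

QUANTIFIER SHAPE (referee precision, ref-4 g57): the rows `rowA`, `rowA'` and the pattern `pairAA'`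
are assumed only AT THE FIBRE PAIR `(ℓ, L)` under consideration (geometrically: a SLOPED pair — the rows
of record are those of all-sloped triples), while the fans `fanA`, `fanA'`, the companions `crossA`,
`crossA'` and the balance `balA` are global (they are direction-free catalogue facts ∕ the W-law at every
grid point, and the proof uses them at the crossed pair `(ℓ*, L*)`, whose lines may be axis lines).

WHAT IS PROVED. `fibre_balanced` : under the axioms every fibre is balanced (hence — outside the
kernel — the Weil coefficient `ŵ(Z) = Σ α_ℓ α_L σ(fibre)` vanishes).  Mechanism (`systems_eq`): the
A-system at any A-foot and the A′-system at any A′-foot of a triple coincide; feet are inherited inside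
this common system; so the distinct systems partition the fibre, and a disjoint union of balanced sets
is balanced (`balanced_of_partition`).  No definitions; pure `Finset` counting.

HONEST FRAMING. Finite combinatorics only; no variety, cycle, cohomology class or semiregularity map
occurs; the axioms are hypotheses, not theorems of this file; nothing here bears on HC ∕ HC_CM ∕ HC_AV.
-/

namespace Summit.Ventures.HSemireg
namespace FibrePartition

open Finset

variable {M : Type*}

/-- Slope counts are additive over a pairwise-disjoint family (the counting step). -/
theorem count_biUnion [DecidableEq M] (slope : M → Fin 3) {ι : Type*} (s : Finset ι)
    (t : ι → Finset M) (h : (s : Set ι).PairwiseDisjoint t) (c : Fin 3) :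
    ((s.biUnion t).filter fun m => slope m = c).card
      = ∑ i ∈ s, ((t i).filter fun m => slope m = c).card := by
  rw [filter_biUnion]
  refine card_biUnion ?_
  intro i hi j hj hne
  exact disjoint_filter_filter (h hi hj hne)

/-- A set covered by a pairwise-disjoint family of balanced sets (every slope equally often) is
balanced. -/
theorem balanced_of_partition [DecidableEq M] (slope : M → Fin 3) {ι : Type*} (s : Finset ι)
    (t : ι → Finset M) (h : (s : Set ι).PairwiseDisjoint t)
    (hbal : ∀ i ∈ s, ∀ c c' : Fin 3,
      ((t i).filter fun m => slope m = c).card = ((t i).filter fun m => slope m = c').card)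
    (c c' : Fin 3) :
    ((s.biUnion t).filter fun m => slope m = c).card
      = ((s.biUnion t).filter fun m => slope m = c').card := by
  rw [count_biUnion slope s t h c, count_biUnion slope s t h c']
  exact sum_congr rfl fun i hi => hbal i hi c c'

section Core

variable {P₁ P₂ L₁ L₂ : Type*}
variable (on₁ : P₁ → L₁ → Prop) (on₂ : P₂ → L₂ → Prop)
  (F : L₁ → L₂ → Finset M) (SA : P₁ → Finset M) (SA' : P₂ → Finset M)

/-- A member of another slope exists in a balanced system containing `m` (from (W3)). -/
theorem exists_other_slope (slope : M → Fin 3) (S : Finset M)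
    (hbal : ∀ c c' : Fin 3,
      (S.filter fun m => slope m = c).card = (S.filter fun m => slope m = c').card)
    {m : M} (hm : m ∈ S) : ∃ m₁ ∈ S, slope m₁ ≠ slope m := by
  classical
  -- some slope `c ≠ slope m` exists in `Fin 3`, and its count equals the (positive) count of `slope m`
  obtain ⟨c, hc⟩ : ∃ c : Fin 3, c ≠ slope m :=
    ⟨slope m + 1, by generalize slope m = x; revert x; decide⟩
  have hpos : 0 < (S.filter fun x => slope x = slope m).card :=
    card_pos.2 ⟨m, mem_filter.2 ⟨hm, rfl⟩⟩
  rw [hbal (slope m) c] at hpos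
  obtain ⟨m₁, hm₁⟩ := card_pos.1 hpos
  exact ⟨m₁, (mem_filter.1 hm₁).1, by rw [(mem_filter.1 hm₁).2]; exact hc⟩

/-- **Fan upgrade.** From the catalogue A-fan (non-parallel members) and (W3) at `p`: the WHOLE
A-system at an A-foot `p` of a triple `(ℓ,L,m)` lies in the fibre over `(ℓ,L)` (parallel members via a
member of another slope). `ℓ`, `L` of any direction. -/
theorem fan_all (slope : M → Fin 3)
    (balA : ∀ (p : P₁) (c c' : Fin 3),
      ((SA p).filter fun m => slope m = c).card = ((SA p).filter fun m => slope m = c').card)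
    (fanA : ∀ (ℓ : L₁) (L : L₂) (m : M) (p : P₁) (m' : M),
      m ∈ F ℓ L → on₁ p ℓ → m ∈ SA p → m' ∈ SA p → slope m' ≠ slope m → m' ∈ F ℓ L)
    {ℓ : L₁} {L : L₂} {m : M} {p : P₁} (hT : m ∈ F ℓ L) (hp : on₁ p ℓ) (hA : m ∈ SA p)
    {m' : M} (hm' : m' ∈ SA p) : m' ∈ F ℓ L := by
  by_cases hs : slope m' = slope m
  · obtain ⟨m₁, hm₁, hs₁⟩ := exists_other_slope slope (SA p) (balA p) hA
    have h₁ : m₁ ∈ F ℓ L := fanA ℓ L m p m₁ hT hp hA hm₁ hs₁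
    exact fanA ℓ L m₁ p m' h₁ hp hm₁ hm' (by rw [hs]; exact fun h => hs₁ h.symm)
  · exact fanA ℓ L m p m' hT hp hA hm' hs

/-- **Systems coincide.** At an A-foot `p` and an A′-foot `q` of a triple `(ℓ,L,m)` the A-system at
`p` equals the A′-system at `q` — the heart of THEOREM F: (A·A′) gives the second, crossed triple
`(ℓ*,L*,m)`, the fans carry both systems over to `(ℓ*,L*)`, and (X·A) ∕ (X·A′) exchange the pads.
Only (W3) at `p` is used (parallel members of the A′-system are reached through a member of the
A-system of another slope). -/
theorem systems_eq (slope : M → Fin 3)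
    (balA : ∀ (p : P₁) (c c' : Fin 3),
      ((SA p).filter fun m => slope m = c).card = ((SA p).filter fun m => slope m = c').card)
    (fanA : ∀ (ℓ₀ : L₁) (L₀ : L₂) (m : M) (p : P₁) (m' : M),
      m ∈ F ℓ₀ L₀ → on₁ p ℓ₀ → m ∈ SA p → m' ∈ SA p → slope m' ≠ slope m → m' ∈ F ℓ₀ L₀)
    (fanA' : ∀ (ℓ₀ : L₁) (L₀ : L₂) (m : M) (q : P₂) (m' : M),
      m ∈ F ℓ₀ L₀ → on₂ q L₀ → m ∈ SA' q → m' ∈ SA' q → slope m' ≠ slope m → m' ∈ F ℓ₀ L₀)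
    (crossA : ∀ (ℓ₀ ℓ' : L₁) (L₀ L' : L₂) (m : M) (p : P₁) (q : P₂),
      ℓ' ≠ ℓ₀ → L' ≠ L₀ → on₁ p ℓ₀ → on₁ p ℓ' → on₂ q L₀ → on₂ q L' →
        m ∈ F ℓ₀ L₀ → m ∈ F ℓ' L' → m ∈ SA p → m ∈ SA' q)
    (crossA' : ∀ (ℓ₀ ℓ' : L₁) (L₀ L' : L₂) (m : M) (p : P₁) (q : P₂),
      ℓ' ≠ ℓ₀ → L' ≠ L₀ → on₁ p ℓ₀ → on₁ p ℓ' → on₂ q L₀ → on₂ q L' →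
        m ∈ F ℓ₀ L₀ → m ∈ F ℓ' L' → m ∈ SA' q → m ∈ SA p)
    (ℓ : L₁) (L : L₂)
    (pairAA' : ∀ (m : M) (p : P₁) (q : P₂),
      m ∈ F ℓ L → on₁ p ℓ → on₂ q L → m ∈ SA p → m ∈ SA' q →
        ∃ ℓ' L', ℓ' ≠ ℓ ∧ L' ≠ L ∧ on₁ p ℓ' ∧ on₂ q L' ∧ m ∈ F ℓ' L')
    {m : M} {p : P₁} {q : P₂}
    (hT : m ∈ F ℓ L) (hp : on₁ p ℓ) (hA : m ∈ SA p) (hq : on₂ q L) (hA' : m ∈ SA' q) :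
    SA p = SA' q := by
  obtain ⟨ℓ', L', hne₁, hne₂, hp', hq', hR⟩ := pairAA' m p q hT hp hq hA hA'
  -- the A-system at p lies in both fibres (fan upgrade at p, for T and for R) and hence in SA' q
  have hsub : ∀ m', m' ∈ SA p → m' ∈ F ℓ L ∧ m' ∈ F ℓ' L' ∧ m' ∈ SA' q := by
    intro m' hm'
    have h₁ : m' ∈ F ℓ L := fan_all on₁ F SA slope balA fanA hT hp hA hm'
    have h₂ : m' ∈ F ℓ' L' := fan_all on₁ F SA slope balA fanA hR hp' hA hm'
    exact ⟨h₁, h₂, crossA ℓ ℓ' L L' m' p q hne₁ hne₂ hp hp' hq hq' h₁ h₂ hm'⟩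
  ext m'
  constructor
  · intro hm'
    exact (hsub m' hm').2.2
  · intro hm'
    -- reach m' from a member m₁ ∈ SA p of another slope (m₁ ∈ SA' q by hsub), by the A′-fans at q
    by_cases hs : slope m' = slope m
    · obtain ⟨m₁, hm₁, hs₁⟩ := exists_other_slope slope (SA p) (balA p) hA
      obtain ⟨h₁T, h₁R, h₁q⟩ := hsub m₁ hm₁
      have hs' : slope m' ≠ slope m₁ := by rw [hs]; exact fun h => hs₁ h.symm
      exact crossA' ℓ ℓ' L L' m' p q hne₁ hne₂ hp hp' hq hq'
        (fanA' ℓ L m₁ q m' h₁T hq h₁q hm' hs') (fanA' ℓ' L' m₁ q m' h₁R hq' h₁q hm' hs') hm'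
    · exact crossA' ℓ ℓ' L L' m' p q hne₁ hne₂ hp hp' hq hq'
        (fanA' ℓ L m q m' hT hq hA' hm' hs) (fanA' ℓ' L' m q m' hR hq' hA' hm' hs) hm'

/-- **THEOREM F (fibre partition), kernel form.** Under the incidence axioms of the named-lemma tier
(A-∕A′-rows, (W3) balance of the A-systems, catalogue A-∕A′-fans for non-parallel members, (A·A′),
(X·A)∕(X·A′)) every slot-3 fibre is balanced: each slope occurs equally often in `F ℓ L`. -/
theorem fibre_balanced (slope : M → Fin 3)
    (balA : ∀ (p : P₁) (c c' : Fin 3),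
      ((SA p).filter fun m => slope m = c).card = ((SA p).filter fun m => slope m = c').card)
    (fanA : ∀ (ℓ₀ : L₁) (L₀ : L₂) (m : M) (p : P₁) (m' : M),
      m ∈ F ℓ₀ L₀ → on₁ p ℓ₀ → m ∈ SA p → m' ∈ SA p → slope m' ≠ slope m → m' ∈ F ℓ₀ L₀)
    (fanA' : ∀ (ℓ₀ : L₁) (L₀ : L₂) (m : M) (q : P₂) (m' : M),
      m ∈ F ℓ₀ L₀ → on₂ q L₀ → m ∈ SA' q → m' ∈ SA' q → slope m' ≠ slope m → m' ∈ F ℓ₀ L₀)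
    (crossA : ∀ (ℓ₀ ℓ' : L₁) (L₀ L' : L₂) (m : M) (p : P₁) (q : P₂),
      ℓ' ≠ ℓ₀ → L' ≠ L₀ → on₁ p ℓ₀ → on₁ p ℓ' → on₂ q L₀ → on₂ q L' →
        m ∈ F ℓ₀ L₀ → m ∈ F ℓ' L' → m ∈ SA p → m ∈ SA' q)
    (crossA' : ∀ (ℓ₀ ℓ' : L₁) (L₀ L' : L₂) (m : M) (p : P₁) (q : P₂),
      ℓ' ≠ ℓ₀ → L' ≠ L₀ → on₁ p ℓ₀ → on₁ p ℓ' → on₂ q L₀ → on₂ q L' →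
        m ∈ F ℓ₀ L₀ → m ∈ F ℓ' L' → m ∈ SA' q → m ∈ SA p)
    (ℓ : L₁) (L : L₂)
    (rowA : ∀ m : M, m ∈ F ℓ L → ∃ p, on₁ p ℓ ∧ m ∈ SA p)
    (rowA' : ∀ m : M, m ∈ F ℓ L → ∃ q, on₂ q L ∧ m ∈ SA' q)
    (pairAA' : ∀ (m : M) (p : P₁) (q : P₂),
      m ∈ F ℓ L → on₁ p ℓ → on₂ q L → m ∈ SA p → m ∈ SA' q →
        ∃ ℓ' L', ℓ' ≠ ℓ ∧ L' ≠ L ∧ on₁ p ℓ' ∧ on₂ q L' ∧ m ∈ F ℓ' L')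
    (c c' : Fin 3) :
    ((F ℓ L).filter fun m => slope m = c).card = ((F ℓ L).filter fun m => slope m = c').card := by
  classical
  -- the class of `m`: the A-system at some A-foot of `(ℓ,L,m)` (empty if `m` is not in the fibre)
  let cls : M → Finset M := fun m =>
    if h : ∃ p, on₁ p ℓ ∧ m ∈ SA p then SA (Classical.choose h) else ∅
  -- (1) for `m` in the fibre, `cls m` is the A-system at a genuine A-foot
  have hcls : ∀ m, m ∈ F ℓ L → ∃ p, on₁ p ℓ ∧ m ∈ SA p ∧ cls m = SA p := by
    intro m hm
    have h : ∃ p, on₁ p ℓ ∧ m ∈ SA p := rowA m hm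
    refine ⟨Classical.choose h, (Classical.choose_spec h).1, (Classical.choose_spec h).2, ?_⟩
    simp only [cls, dif_pos h]
  -- (2) any two A-feet of the same fibre member carry the same system (both equal an A′-system)
  have hfeet : ∀ m p p', m ∈ F ℓ L → on₁ p ℓ → m ∈ SA p → on₁ p' ℓ → m ∈ SA p' →
      SA p = SA p' := by
    intro m p p' hm hp hA hp' hA'
    obtain ⟨q, hq, hAq⟩ := rowA' m hm
    rw [systems_eq on₁ on₂ F SA SA' slope balA fanA fanA' crossA crossA' ℓ L pairAA' hm hp hA hq hAq,
      systems_eq on₁ on₂ F SA SA' slope balA fanA fanA' crossA crossA' ℓ L pairAA' hm hp' hA' hq hAq]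
  -- (3) feet are inherited inside a class: `m' ∈ cls m ⇒ cls m' = cls m`
  have hstable : ∀ m m', m ∈ F ℓ L → m' ∈ cls m → m' ∈ F ℓ L ∧ cls m' = cls m := by
    intro m m' hm hm'
    obtain ⟨p, hp, hA, hc⟩ := hcls m hm
    rw [hc] at hm'
    have hm'T : m' ∈ F ℓ L := fan_all on₁ F SA slope balA fanA hm hp hA hm'
    obtain ⟨p', hp', hA', hc'⟩ := hcls m' hm'T
    exact ⟨hm'T, by rw [hc', hc, hfeet m' p' p hm'T hp' hA' hp hm']⟩
  -- (4) the fibre is the union of the classes of its members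
  have hcover : F ℓ L = ((F ℓ L).image cls).biUnion id := by
    ext m'
    simp only [mem_biUnion, mem_image, id]
    constructor
    · intro hm'
      refine ⟨cls m', ⟨m', hm', rfl⟩, ?_⟩
      obtain ⟨p, -, hA, hc⟩ := hcls m' hm'
      rw [hc]; exact hA
    · rintro ⟨B, ⟨m, hm, rfl⟩, hmB⟩
      exact (hstable m m' hm hmB).1
  -- (5) distinct classes are disjoint
  have hdisj : (((F ℓ L).image cls : Finset (Finset M)) : Set (Finset M)).PairwiseDisjoint id := by
    intro B hB B' hB' hne
    rw [Finset.mem_coe, Finset.mem_image] at hB hB'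
    obtain ⟨m₁, hm₁, rfl⟩ := hB
    obtain ⟨m₂, hm₂, rfl⟩ := hB'
    rw [Function.onFun, id, id, Finset.disjoint_left]
    intro m' h₁ h₂
    exact hne (((hstable m₁ m' hm₁ h₁).2).symm.trans (hstable m₂ m' hm₂ h₂).2)
  -- (6) each class is balanced (W3), so the fibre is balanced
  rw [hcover]
  refine balanced_of_partition slope _ id hdisj ?_ c c'
  intro B hB
  obtain ⟨m, hm, rfl⟩ := Finset.mem_image.1 hB
  obtain ⟨p, -, -, hc⟩ := hcls m hm
  simp only [id, hc]
  exact balA p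

end Core

end FibrePartition
end Summit.Ventures.HSemireg
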